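import Summits.Ventures.HSemireg.TwoLevelObstructionExtension
import Summits.Ventures.HSemireg.Pad4FirstOrderModelEnd
import HarnessLib

/-!
# Venture HSemireg — THE BRIDGE STATEMENT MOD FRAME: `KunnethLerayFrame` (B3 + B4 as ONE hypothesis structure) and the kernel
# implication «FRAME ⇒ (ob_κ(E) = 0 for all κ ⇒ row 716's `H2`)», with the corollary against `theoremLZeta_holds`

HONEST FRAMING. Lean side of the computation cell `pub-hsemireg` (S4-PUSH, H2 door PAD-4; seat s4-prove-1 g29, 2026-08-28;
TIER-3, object (c6) of director-hodge R14.1 ∕ R14.3, priced on the cell bus l.32638; sizing note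
`s4push/prove-1/TIER3-SIZING-ModelToSheafBridge-prove-1-g25.md` §3 ∕ §5 (ii)). The model→sheaf bridge of row 716
(`Pad4FirstOrderModel.lean`, `theoremLZeta_holds` in `Pad4FirstOrderModelEnd.lean`) reads

  (BR)  for a geometric two-level ⊕-block line-bundle design `0 → ⊕_j P_j →φ ⊕_i N_i → E → 0` on `S⁴` realising a model design
        `D`, «`ob_κ(E) = At'(E) ≫ c_κ(E) = 0` for every direction `κ`» ⇒ `D.H2 (sections of φ)`.

Its homological half is a THEOREM of the tree with NO functoriality hypothesis left (B1 `TwoLevelObstructionFactorisation`,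
B2 `TwoLevelObstructionAtiyah` + `AtiyahClassConnecting` + `ExtClassNineDiagram`, (c) `ExtensionContraction` +
`TwoLevelObstructionExtension`: `design_lower_and_upper_of_extension`). What is NOT a theorem — and is not a 2026 Lean target —
is the DICTIONARY between the `Ext`-groups of the constituents and row 716's Künneth–Leray coordinate spaces (B3: `H^q(S_f, ±d ℓ_ζ)`
= `R_d`, `R_d ⊗ W`, `R_d^*`, `R_d^* ⊗ W` with the `coef` ∕ `coefProd` products) together with the line-bundle demand (B4:
`ob_κ(L) = (κ ∪ c₁ L)^{0,2}` = 716 `ob`). This file TYPES that dictionary as ONE hypothesis structure and proves the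
implication from it:

* `KunnethLerayFrame X D h` (§1) — FIELDS ONLY, all over tree declarations: a geometric realisation of `D` in `X.left.Modules`
  (`N, P, E, φ, g`, the design sequence short exact, its `𝓗om(𝒯, –)`-twist short exact), for every `κ : Matrix (Fin 4) (Fin 4) ℂ`
  (`T_W ≅ M₄(ℂ)`, 716 `kap`) an extension `0 → 𝒯 → K κ → 𝒪_X → 0`, coordinate maps `sec` (sections, `H⁰(N_r − P_j)`, indices
  `idxH0`), `unk` (unknowns, `H²(P_j − N_i)`), ADDITIVE `low` ∕ `upp` (rows, `H²(N_r − N_i)` ∕ `H²(P_j − P_s)`, indices `idxH2`),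
  two PRODUCT fields (`low`∕`upp` of a Yoneda product `η ∘ φ_{rj}` ∕ `φ_{is} ∘ η′` = the corresponding summand of 716
  `lowerLHS` ∕ `upperLHS`, the upper one under 716's own guard `UpperRowPure`) and two DEMAND fields (`low i i (ob_κ(N i)) = ob (D.N i) κ`,
  `upp j j (ob_κ(P j)) = ob (D.P j) κ` on `idxH2`) — B3 + B4 verbatim as the model uses them, nothing more;
* `KunnethLerayFrame.H2_of_forall_obExt_eq_zero` (§2): **FRAME ⇒ ((∀ κ, ob_κ(E) = 0) ⇒ `D.H2 F.sections`)** — per `κ` the tree's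
  `design_lower_and_upper_of_extension`, pushed through the additive coordinate maps (`map_sum`, `map_zero`) and the four fields;
  every upper row is obtained, 716's guard a fortiori;
* `KunnethLerayFrame.not_forall_obExt_eq_zero` (§3): **FRAME ∧ `D.InClassY` ∧ `D.Minimal F.sections` ∧ `D.H1` ⇒ ¬ ∀ κ, ob_κ(E) = 0**
  — read off `theoremLZeta_holds` with no new hypothesis: the census words' geometric no-go as «MODEL theorem + kernel
  implication from ONE named hypothesis structure».

An INHABITANT of `KunnethLerayFrame X D h` for the actual line bundles on `S⁴ = (E_i × E_i)⁴` is B3 ∕ B4 proper (coherent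
cohomology of abelian surfaces with cup products; not in Mathlib) and is NOT constructed or claimed. No Literature fact
(`def … : Prop`) is declared or used; no instance, no notation; no edit of row 716; census-neutral. NOTHING HERE SAYS THAT
HC ∕ HC_CM ∕ HC_AV ∕ W₆ ∕ HC_Kum4Type HOLDS OR FAILS; `theoremLZeta_holds` stays a theorem of the first-order MODEL; (S3) ∕ (S5)
status words do not move; nothing here is a statement about `stub_rung_pad4_seedAt`. Research route conditional on HC_CM; not a corollary.
-/

noncomputable section
namespace Summit.Ventures.HSemireg.TwoLevelObstruction

open CategoryTheory CategoryTheory.Abelian CategoryTheory.Limits AlgebraicGeometry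
open Literature.AlgebraicGeometry.HodgeTheory Literature.AlgebraicGeometry.Modules
  Literature.AlgebraicGeometry.Motives
open Summit.Ventures.HSemireg.Pad4FirstOrder

universe w u

variable {k : Type u} [CommRing k] (X : Over (Spec (CommRingCat.of k))) [HasExt.{w} X.left.Modules]
  [HasFiniteBiproducts X.left.Modules]

/-! ## §1 The Künneth–Leray frame: B3 + B4 as ONE hypothesis structure -/

/-- **The Künneth–Leray frame of a model design `D`** (row 716) in degree `n` (`1 + 1 = n`): a geometric realisation of `D` as
a two-level design of `𝒪_X`-modules together with the DICTIONARY (B3) between the `Ext`-groups of its constituents and 716's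
coordinate spaces — sections `H⁰(N_r − P_j)` (indices `idxH0`), unknowns `H²(P_j − N_i)` and rows `H²(N_r − N_i)`,
`H²(P_j − P_s)` (indices `idxH2`), Yoneda products read by `coefProd` exactly as in 716 `lowerLHS` ∕ `upperLHS` — and the
line-bundle demand (B4) `ob_κ = 716 ob` on the diagonal blocks, for every direction `κ ∈ T_W ≅ M₄(ℂ)` realised as an
extension of `𝒪_X` by `𝒯`. A HYPOTHESIS structure: no inhabitant is constructed in the tree. [definition of this file] -/
structure KunnethLerayFrame (D : Design) {n : ℕ} (h : 1 + 1 = n) where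
  /-- the lower constituents `N_i` (summands of `E₋`) as `𝒪_X`-modules. -/
  N : Fin D.nN → X.left.Modules
  /-- the upper constituents `P_j` (summands of `E₊`). -/
  P : Fin D.nP → X.left.Modules
  /-- the presented object `E`. -/
  E : X.left.Modules
  /-- the presentation `φ : ⊕ P → ⊕ N`. -/
  φ : ⨁ P ⟶ ⨁ N
  /-- the quotient map `⊕ N → E`. -/
  g : ⨁ N ⟶ E
  /-- `φ ≫ g = 0`. -/
  w : φ ≫ g = 0
  /-- the design sequence `0 → ⊕ P → ⊕ N → E → 0` is short exact. -/
  hS : (ShortComplex.mk φ g w).ShortExact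
  /-- its twist `𝓗om(𝒯, –)` is short exact (automatic for `𝒯` finite locally free). -/
  hTS : ((ShortComplex.mk φ g w).map (sheafHomFunctor (tangentSheaf X))).ShortExact
  /-- the extension module `K κ` of the direction `κ ∈ T_W ≅ M₄(ℂ)` (716 `kap`). -/
  K : Matrix (Fin 4) (Fin 4) ℂ → X.left.Modules
  /-- `𝒯 → K κ`. -/
  ι : ∀ κ, tangentSheaf X ⟶ K κ
  /-- `K κ → 𝒪_X`. -/
  π : ∀ κ, K κ ⟶ unitModule X.left
  /-- `ι κ ≫ π κ = 0`. -/
  wκ : ∀ κ, ι κ ≫ π κ = 0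
  /-- `0 → 𝒯 → K κ → 𝒪_X → 0` is short exact: the direction `κ` as a class in `Ext¹(𝒪_X, 𝒯) = H¹(X, 𝒯)`. -/
  hκ : ∀ κ, (ShortComplex.mk (ι κ) (π κ) (wκ κ)).ShortExact
  /-- B3, sections: the Künneth coordinates (indices `idxH0 (D.N r) (D.P j)`) of an entry `P_j → N_r` (`H⁰(N_r − P_j)`). -/
  sec : ∀ (r : Fin D.nN) (j : Fin D.nP), (P j ⟶ N r) → (Fin 4 → ℕ × ℕ) → ℂ
  /-- B3, unknowns: the coordinates (indices `idxH2 (D.P j) (D.N i)`) of a class in `Extⁿ(N_i, P_j) = H²(P_j − N_i)`. -/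
  unk : ∀ (i : Fin D.nN) (j : Fin D.nP), Ext.{w} (N i) (P j) n → (Fin 4 → ℕ) → (Fin 4 → ℕ × ℕ) → ℂ
  /-- B3, lower rows: the coordinates (indices `idxH2 (D.N r) (D.N i)`) on `Extⁿ(N_i, N_r) = H²(N_r − N_i)`, additive. -/
  low : ∀ (i r : Fin D.nN), Ext.{w} (N i) (N r) n →+ ((Fin 4 → ℕ) × (Fin 4 → ℕ × ℕ) → ℂ)
  /-- B3, upper rows: the coordinates (indices `idxH2 (D.P j) (D.P s)`) on `Extⁿ(P_s, P_j) = H²(P_j − P_s)`, additive. -/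
  upp : ∀ (s j : Fin D.nP), Ext.{w} (P s) (P j) n →+ ((Fin 4 → ℕ) × (Fin 4 → ℕ × ℕ) → ℂ)
  /-- B3, lower products: the coordinates of `η ∘ φ_{rj}` (`η ∈ H²(P_j − N_i)`) on a kept index of `H²(N_r − N_i)` are 716's
  `coefProd`-bilinear expression in the coordinates of `φ_{rj}` and `η` — the `j`-summand of `Design.lowerLHS`. -/
  low_comp : ∀ (i r : Fin D.nN) (j : Fin D.nP) (η : Ext.{w} (N i) (P j) n) (t : (Fin 4 → ℕ) × (Fin 4 → ℕ × ℕ)),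
    t ∈ idxH2 (D.N r) (D.N i) →
      low i r (η.comp (Ext.mk₀ (entry φ r j)) (add_zero n)) t =
        ∑ u ∈ idxH2 (D.P j) (D.N i), ∑ a ∈ idxH0 (D.N r) (D.P j),
          (if u.1 = t.1 then coefProd (rel (D.P j) (D.N i)) (rel (D.N r) (D.P j)) t.1 u.2 a t.2 else 0) *
            sec r j (entry φ r j) a * unk i j η u.1 u.2
  /-- B3, upper products, under 716's guard `UpperRowPure j s` (all participants of the row modelled): the coordinates of
  `φ_{is} ∘ η′` (`η′ ∈ H²(P_j − N_i)`) on a kept index of `H²(P_j − P_s)` — the `i`-summand of `Design.upperLHS`. -/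
  upp_comp : ∀ (j s : Fin D.nP), D.UpperRowPure j s → ∀ (i : Fin D.nN) (η : Ext.{w} (N i) (P j) n)
    (t : (Fin 4 → ℕ) × (Fin 4 → ℕ × ℕ)), t ∈ idxH2 (D.P j) (D.P s) →
      upp s j ((Ext.mk₀ (entry φ i s)).comp η (zero_add n)) t =
        ∑ u ∈ idxH2 (D.P j) (D.N i), ∑ a ∈ idxH0 (D.N i) (D.P s),
          (if u.1 = t.1 then coefProd (rel (D.P j) (D.N i)) (rel (D.N i) (D.P s)) t.1 u.2 a t.2 else 0) *
            sec i s (entry φ i s) a * unk i j η u.1 u.2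
  /-- B4, lower demand: the coordinates of `ob_κ(N_i) = At'(N_i) ≫ c_κ(N_i)` on `H²(N_i − N_i) = H²(𝒪)` are 716's `ob (D.N i) κ`. -/
  low_ob : ∀ (κ : Matrix (Fin 4) (Fin 4) ℂ) (i : Fin D.nN) (t : (Fin 4 → ℕ) × (Fin 4 → ℕ × ℕ)),
    t ∈ idxH2 (D.N i) (D.N i) → low i i (obExt (hκ κ) h (N i)) t = ob (D.N i) κ t.1 t.2
  /-- B4, upper demand: the coordinates of `ob_κ(P_j)` on `H²(P_j − P_j)` are 716's `ob (D.P j) κ`. -/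
  upp_ob : ∀ (κ : Matrix (Fin 4) (Fin 4) ℂ) (j : Fin D.nP) (t : (Fin 4 → ℕ) × (Fin 4 → ℕ × ℕ)),
    t ∈ idxH2 (D.P j) (D.P j) → upp j j (obExt (hκ κ) h (P j)) t = ob (D.P j) κ t.1 t.2

namespace KunnethLerayFrame

variable {X} {D : Design} {n : ℕ} {h : 1 + 1 = n} (F : KunnethLerayFrame X D h)

/-- **The model sections of the frame**: `φ r j a :=` the `a`-coordinate of the entry `φ_{rj} : P_j → N_r` — the `D.Sections`
at which row 716's `H2` is read. [definition of this file] -/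
def sections : D.Sections := fun r j a => F.sec r j (entry F.φ r j) a

/-- Unfolding lemma for `sections`. -/
theorem sections_apply (r : Fin D.nN) (j : Fin D.nP) (a : Fin 4 → ℕ × ℕ) :
    F.sections r j a = F.sec r j (entry F.φ r j) a := rfl

/-! ## §2 FRAME ⇒ (ob_κ(E) = 0 for all κ ⇒ 716 `H2`) -/

/-- The lower system read through the frame: on a kept index `t` of `H²(N_r − N_i)`, 716's `lowerLHS` at the model sections
and the coordinates of the unknowns `η_j` IS the coordinate of the Yoneda sum `Σ_j η_j ∘ φ_{rj}`. -/
theorem lowerLHS_eq (i r : Fin D.nN) (η : ∀ j, Ext.{w} (F.N i) (F.P j) n)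
    (t : (Fin 4 → ℕ) × (Fin 4 → ℕ × ℕ)) (ht : t ∈ idxH2 (D.N r) (D.N i)) :
    D.lowerLHS F.sections (fun j q o => F.unk i j (η j) q o) i r t =
      F.low i r (∑ j, (η j).comp (Ext.mk₀ (entry F.φ r j)) (add_zero n)) t := by
  rw [map_sum, Finset.sum_apply]
  exact Finset.sum_congr rfl fun j _ => (F.low_comp i r j (η j) t ht).symm

/-- The upper system read through the frame (guarded rows): on a kept index `t` of `H²(P_j − P_s)` with `UpperRowPure j s`,
716's `upperLHS` IS the coordinate of `Σ_i φ_{is} ∘ η′_i`. -/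
theorem upperLHS_eq (j s : Fin D.nP) (hp : D.UpperRowPure j s) (η : ∀ i, Ext.{w} (F.N i) (F.P j) n)
    (t : (Fin 4 → ℕ) × (Fin 4 → ℕ × ℕ)) (ht : t ∈ idxH2 (D.P j) (D.P s)) :
    D.upperLHS F.sections (fun i q o => F.unk i j (η i) q o) j s t =
      F.upp s j (∑ i, (Ext.mk₀ (entry F.φ i s)).comp (η i) (zero_add n)) t := by
  rw [map_sum, Finset.sum_apply]
  exact Finset.sum_congr rfl fun i _ => (F.upp_comp j s hp i (η i) t ht).symm

/-- **FRAME ⇒ 716's lower systems**: if `ob_κ(E) = 0` then every column `N_i` of `φ ∘ η = ob_κ(E₋)` is solvable in the model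
(all rows), for this `κ`. -/
theorem lowerColumnSolvable_of_obExt_eq_zero (κ : Matrix (Fin 4) (Fin 4) ℂ) (h0 : obExt (F.hκ κ) h F.E = 0)
    (i : Fin D.nN) : D.LowerColumnSolvable F.sections κ i := by
  obtain ⟨η, hdiag, hoff⟩ := (design_lower_and_upper_of_extension (F.hκ κ) F.hS F.hTS h h0).1 i
  refine ⟨fun j q o => F.unk i j (η j) q o, fun r t ht => ?_⟩
  rw [F.lowerLHS_eq i r η t ht]
  by_cases hri : r = i
  · subst hri
    rw [if_pos rfl, hdiag, F.low_ob κ _ t ht]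
  · rw [if_neg hri, hoff r (Ne.symm hri), map_zero, Pi.zero_apply]

/-- **FRAME ⇒ 716's upper systems**: if `ob_κ(E) = 0` then every row object `P_j` of `η′ ∘ φ = ob_κ(E₊)` is solvable in the
model (all guarded rows), for this `κ`. -/
theorem upperRowSolvable_of_obExt_eq_zero (κ : Matrix (Fin 4) (Fin 4) ℂ) (h0 : obExt (F.hκ κ) h F.E = 0)
    (j : Fin D.nP) : D.UpperRowSolvable F.sections κ j := by
  obtain ⟨η, hdiag, hoff⟩ := (design_lower_and_upper_of_extension (F.hκ κ) F.hS F.hTS h h0).2 j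
  refine ⟨fun i q o => F.unk i j (η i) q o, fun s hp t ht => ?_⟩
  rw [F.upperLHS_eq j s hp η t ht]
  by_cases hsj : s = j
  · subst hsj
    rw [if_pos rfl, hdiag, F.upp_ob κ _ t ht]
  · rw [if_neg hsj, hoff s hsj, map_zero, Pi.zero_apply]

/-- **THE BRIDGE MOD FRAME**: given a Künneth–Leray frame of `D`, if the obstruction `ob_κ(E) = At'(E) ≫ c_κ(E)` vanishes for
EVERY direction `κ ∈ T_W ≅ M₄(ℂ)`, then row 716's `(H2) = (E1)` holds at the frame's sections. The only hypothesis beyond the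
tree's theorems is the frame itself (B3 + B4). -/
theorem H2_of_forall_obExt_eq_zero (h0 : ∀ κ : Matrix (Fin 4) (Fin 4) ℂ, obExt (F.hκ κ) h F.E = 0) :
    D.H2 F.sections := fun κ =>
  ⟨F.lowerColumnSolvable_of_obExt_eq_zero κ (h0 κ), F.upperRowSolvable_of_obExt_eq_zero κ (h0 κ)⟩

/-! ## §3 The corollary against `theoremLZeta_holds` -/

/-- **THE CENSUS WORDS' GEOMETRIC NO-GO, MOD FRAME**: for a model design `D` of class y (`D.InClassY`) carrying a Künneth–Leray
frame whose sections are a minimal presentation (`D.Minimal F.sections`), `(H1)` (`D.mu ≠ 0`) forces SOME direction `κ ∈ T_W`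
with `ob_κ(E) ≠ 0` — `theoremLZeta_holds` (THEOREM L^ζ of the first-order model) composed with `H2_of_forall_obExt_eq_zero`;
binders literally those of `TheoremLZeta`. -/
theorem not_forall_obExt_eq_zero (hY : D.InClassY) (hmin : D.Minimal F.sections) (h1 : D.H1) :
    ¬ ∀ κ : Matrix (Fin 4) (Fin 4) ℂ, obExt (F.hκ κ) h F.E = 0 := fun h0 =>
  theoremLZeta_holds D F.sections hY hmin ⟨h1, F.H2_of_forall_obExt_eq_zero h0⟩

/-- The same, existential form: `∃ κ, ob_κ(E) ≠ 0`. -/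
theorem exists_obExt_ne_zero (hY : D.InClassY) (hmin : D.Minimal F.sections) (h1 : D.H1) :
    ∃ κ : Matrix (Fin 4) (Fin 4) ℂ, obExt (F.hκ κ) h F.E ≠ 0 :=
  not_forall.mp (F.not_forall_obExt_eq_zero hY hmin h1)

end KunnethLerayFrame

end Summit.Ventures.HSemireg.TwoLevelObstruction

end
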